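import Summits.QuantumFields.BalabanUV.T4Continuum.Support.NE7CriticalFirstVariationGeneral
import HarnessLib

/-!
# NE7CriticalPairingLetter — THE EULER–LAGRANGE PAIRING LETTER of the torus road (memo §7 (T3)): at a TANGENT-CRITICAL configuration `U` the first variation of
# ANY skew periodic direction `Z` is paid only through the LINEARISED AVERAGE of `Z` — `|dAction U Z| ≤ c_R·‖D_U Z‖_{ℓ¹(coarse)}` for any exact right inverse `R`
# of `D_U` with first-variation bound `c_R` (row NE3's `rightInvW`: `c_R = a·(curl1C∕(1−θℓ))·M^d∕M²`) — so for a cut-off flat-tangent test `χ̃Y` the cost is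
# `c_R·‖D_U(χ̃Y)‖₁ = c_R·‖(D_U − D_1)(χ̃Y) + [D_1, χ̃]Y‖₁`: a background-Lipschitz term and a commutator, never the pointwise current

Cell `pub-balaban`, rung (B)+1 sub-cell t4, lineage `b2b-balaban-t4-ne7-p1` (CRUX PROVER NE7 #1 = OWNER of row NE7), generation 88; memo
`t4/b2b-balaban-t4-ne7-p1-g88/EXISTENCE-BY-INDUCTION.md` §7 (T3).  File F249 (over F244 `NE7CriticalFirstVariationGeneral`, F53 `NE7TangentTransportRightInv.abs_dAction_rightInvW_le`,
row NE3's `rightInvW` letters).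

WHY.  In the torus road the criticality defect `τ` of the cutoff representative (F245's `hcritD`) has an INNER part `⟨EL_{U^u}, χ̃Y⟩` (F247's split).  Bounding it by the
pointwise current (F244: `C·δ·M⁻³`) costs `K·C·δ∕M²` after the slice solver — no contraction.  PAIRING instead: `χ̃Y − R(D_U(χ̃Y))` is `U`-tangent, so criticality
leaves `dAction U (R(D_U(χ̃Y)))`, bounded by `c_R·‖D_U(χ̃Y)‖₁`; and `D_U(χ̃Y)` is small because `D_1 Y = 0` (flat tangency of the test) up to the background-Lipschitz
defect `(D_U − D_1)(χ̃Y)` (quadratic after `×KM`) and the commutator `[D_1, χ̃]Y` (`1∕R`-small).  THIS FILE is the pairing step (the two smallness letters are the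
successor's (N2)′ bricks).
WHAT ([folklore]; 0 def, 0 sorry).
§1 **`abs_dAction_le_cR_dirL1_dirIter`** — abstract exact right inverse `R` (skew∕periodic∕exact on skew `N`-periodic coarse data, first-variation bound `c_R`),
   `U` tangent-critical ⟹ `|dAction U Z (perWin)| ≤ c_R·‖D_U Z‖_{ℓ¹(periodBox N)}` for every skew periodic `Z`.
§2 **`abs_dAction_le_dirL1_dirIter_rightInvW`** — `R := rightInvW` (W5∕W6 regime, `SmallField U a`): `|dAction U Z| ≤ a·(curl1C∕(1−θℓ))·(M^d∕M²)·‖D_U Z‖₁`.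
HONEST FRAMING (page 1): composition of tree theorems; nothing of Bałaban's asserted; NOT (APE), NOT ONE-STEP, NOT NE7; spine 0∕9; finite T⁴ rung (B)+1 — NOT infinite
volume, NOT mass gap, NOT `BetaPertH`, NOT Clay.  Continuum YM on T⁴ ⇐ BetaPertH ∧ nine spine estimates (0/9 proved); BetaPertH ⇐ (D1) ∧ (D4) ∧ CAP+tail; G-an2-4
gates asym, D1 and NE2/3/4.
-/

set_option autoImplicit false

open scoped BigOperators Matrix.Norms.L2Operator
open NormedSpace Finset

namespace Summit.QuantumFields.BalabanUV.T4Continuum.NE7CriticalPairingLetter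

open Literature.MathematicalPhysics.QuantumFieldTheory.Balaban1983to89
open B7Prop1Explicit B7Prop2Explicit MatrixLog UnitaryModel
open T4AveragingDeficitWall (IsUnitaryCfg IsSkewDir SmallField dirL1)
open T4AveragingDeficitWallBoundary (IsPeriodicCfg periodBox)
open AveragingDeficitPeriodicCounting (IsPeriodicDir)
open AveragingDeficitMultiLevelPrep (LevelSmall tower)
open AveragingDeficitMultiLevelBridge (tower_eq)
open MinimalActionLevels (perWin)
open NE3TangentCovariantTower (dirIter)
open NE3ResidualSliceRep (dirIter_sub)
open NE3HessForm (dAction)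
open NE3QbarIterCovLiftPrep (cruxC)
open NE3SmoothRightInverseW (rightInvW)
open NE3RightInverseSolveLetters (thetaLoc)
open NE3HatInvCurlLetters (curl1C curl1C_nonneg)
open NE3RightInverseLetters (rightInvW_exact rightInvW_skew rightInvW_periodic)
open NE7TangentTransportGauge (dAction_sub' dirIter_skew_periodic)
open NE7TangentTransportRightInv (abs_dAction_rightInvW_le)

noncomputable section

variable {d : ℕ} {n : Type*} [Fintype n] [DecidableEq n]

/-! ## §1 The pairing letter with an abstract exact right inverse -/

/-- **THE EULER–LAGRANGE PAIRING LETTER (abstract right inverse)**: `U` unitary `T`-periodic (`T = tower L N (k+1)`) of the multi-level class, `R` an exact right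
inverse of `D_U` on skew `N`-periodic coarse data (skew, `T`-periodic outputs) with first-variation bound `c_R`, `U` TANGENT-CRITICAL ⟹ for every skew `T`-periodic
`Z`: `|dAction U Z (perWin d T)| ≤ c_R·‖D_U Z‖_{ℓ¹(periodBox N)}` (`Z − R(D_U Z)` is tangent, criticality kills it). [folklore] -/
theorem abs_dAction_le_cR_dirL1_dirIter [Nonempty n] {L N : ℕ} [NeZero N] (hL : 1 ≤ L) (k : ℕ)
    {U : Site d → Fin d → (Matrix n n ℂ)ˣ} {x : ℝ} (hUu : IsUnitaryCfg U) (hUP : IsPeriodicCfg U ((tower L N (k + 1) : ℕ) : ℤ))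
    (hx : 0 ≤ x) (hs : LevelSmall d L k x) (hUx : SmallField U x)
    (R : (Site d → Fin d → Matrix n n ℂ) → Site d → Fin d → Matrix n n ℂ)
    (hRskew : ∀ φ : Site d → Fin d → Matrix n n ℂ, IsSkewDir φ → IsPeriodicDir φ (N : ℤ) → IsSkewDir (R φ))
    (hRper : ∀ φ : Site d → Fin d → Matrix n n ℂ, IsSkewDir φ → IsPeriodicDir φ (N : ℤ) →
      IsPeriodicDir (R φ) ((tower L N (k + 1) : ℕ) : ℤ))
    (hRexact : ∀ φ : Site d → Fin d → Matrix n n ℂ, IsSkewDir φ → IsPeriodicDir φ (N : ℤ) → dirIter L (k + 1) U (R φ) = φ)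
    {cR : ℝ}
    (hRbd : ∀ φ : Site d → Fin d → Matrix n n ℂ, IsSkewDir φ → IsPeriodicDir φ (N : ℤ) →
      |dAction U (R φ) (perWin d (tower L N (k + 1)))| ≤ cR * dirL1 φ (periodBox (d := d) N))
    (hcrit : ∀ Y' : Site d → Fin d → Matrix n n ℂ, IsSkewDir Y' → IsPeriodicDir Y' ((tower L N (k + 1) : ℕ) : ℤ) →
      dirIter L (k + 1) U Y' = 0 → dAction U Y' (perWin d (tower L N (k + 1))) = 0)
    {Z : Site d → Fin d → Matrix n n ℂ} (hZ : IsSkewDir Z) (hZP : IsPeriodicDir Z ((tower L N (k + 1) : ℕ) : ℤ)) :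
    |dAction U Z (perWin d (tower L N (k + 1)))| ≤ cR * dirL1 (dirIter L (k + 1) U Z) (periodBox (d := d) N) := by
  set ψ : Site d → Fin d → Matrix n n ℂ := dirIter L (k + 1) U Z with hψ
  obtain ⟨hψs, hψP⟩ := dirIter_skew_periodic (M := N) hL k hUu hUP hx hs hUx hZ hZP
  -- the tangent field `Z − Rψ`
  have hTs : IsSkewDir (fun y μ => Z y μ - R ψ y μ) := fun y μ => (skewAdjoint (Matrix n n ℂ)).sub_mem (hZ y μ) (hRskew ψ hψs hψP y μ)
  have hTP : IsPeriodicDir (fun y μ => Z y μ - R ψ y μ) ((tower L N (k + 1) : ℕ) : ℤ) := fun y i μ => by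
    simp only [hZP y i μ, hRper ψ hψs hψP y i μ]
  have hTT : dirIter L (k + 1) U (fun y μ => Z y μ - R ψ y μ) = 0 := by
    rw [dirIter_sub hL k hUu hx hs hUx Z (R ψ), hRexact ψ hψs hψP]
    funext w τ
    simp [hψ]
  have hc := hcrit _ hTs hTP hTT
  rw [dAction_sub', sub_eq_zero] at hc
  rw [hc]
  exact hRbd ψ hψs hψP

/-! ## §2 The letter at `R := rightInvW` -/

/-- **THE EULER–LAGRANGE PAIRING LETTER AT ROW NE3's RIGHT INVERSE**: for `U` unitary `(N·L^{k+1})`-periodic in the W5∕W6 regime (`cruxC·M²x < 1`, `thetaLoc·M²x < 1`,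
`M²x ≤ 1`, class radius `x`), `SmallField U a`, TANGENT-CRITICAL, and every skew periodic `Z`:
`|dAction U Z (perWin)| ≤ a·(curl1C∕(1−θℓ))·(M^d∕M²)·‖D_U Z‖_{ℓ¹(periodBox N)}`. [folklore] -/
theorem abs_dAction_le_dirL1_dirIter_rightInvW [Nonempty n] {L : ℕ} (hL : 2 ≤ L) (k : ℕ) {N : ℕ} [NeZero N] {U : Site d → Fin d → (Matrix n n ℂ)ˣ}
    {x a : ℝ} (hUu : IsUnitaryCfg U) (hUP : IsPeriodicCfg U ((N * L ^ (k + 1) : ℕ) : ℤ)) (hx : 0 ≤ x) (hs : LevelSmall d L k x) (hUx : SmallField U x)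
    (hθ : cruxC d L * (((L : ℝ) ^ (k + 1)) ^ 2 * x) < 1) (hθl : thetaLoc d L * (((L : ℝ) ^ (k + 1)) ^ 2 * x) < 1)
    (hε : ((L : ℝ) ^ (k + 1)) ^ 2 * x ≤ 1) (ha : 0 ≤ a) (hUa : SmallField U a)
    (hcrit : ∀ Y' : Site d → Fin d → Matrix n n ℂ, IsSkewDir Y' → IsPeriodicDir Y' ((N * L ^ (k + 1) : ℕ) : ℤ) →
      dirIter L (k + 1) U Y' = 0 → dAction U Y' (perWin d (N * L ^ (k + 1))) = 0)
    {Z : Site d → Fin d → Matrix n n ℂ} (hZ : IsSkewDir Z) (hZP : IsPeriodicDir Z ((N * L ^ (k + 1) : ℕ) : ℤ)) :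
    |dAction U Z (perWin d (N * L ^ (k + 1)))|
      ≤ (a * ((curl1C d L / (1 - thetaLoc d L * (((L : ℝ) ^ (k + 1)) ^ 2 * x))) * (((L : ℝ) ^ (k + 1)) ^ d / ((L : ℝ) ^ (k + 1)) ^ 2)))
        * dirL1 (dirIter L (k + 1) U Z) (periodBox (d := d) N) := by
  classical
  have hL1 : 1 ≤ L := le_trans (by norm_num) hL
  have htowN : tower L N (k + 1) = N * L ^ (k + 1) := tower_eq L N (k + 1)
  have htow : ((tower L N (k + 1) : ℕ) : ℤ) = ((N * L ^ (k + 1) : ℕ) : ℤ) := by rw [htowN]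
  have hUP' : IsPeriodicCfg U ((tower L N (k + 1) : ℕ) : ℤ) := by rw [htow]; exact hUP
  set R : (Site d → Fin d → Matrix n n ℂ) → Site d → Fin d → Matrix n n ℂ :=
    fun φ => if h : IsSkewDir φ then rightInvW hL k hUu hx hs hUx N hθ h else 0 with hR
  have hRdef : ∀ φ : Site d → Fin d → Matrix n n ℂ, ∀ h : IsSkewDir φ, R φ = rightInvW hL k hUu hx hs hUx N hθ h := fun φ h => by
    simp only [hR, dif_pos h]
  have hRskew : ∀ φ : Site d → Fin d → Matrix n n ℂ, IsSkewDir φ → IsPeriodicDir φ (N : ℤ) → IsSkewDir (R φ) := fun φ hφ _ => by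
    rw [hRdef φ hφ]; exact rightInvW_skew hL k hUu hx hs hUx hθ hφ
  have hRper : ∀ φ : Site d → Fin d → Matrix n n ℂ, IsSkewDir φ → IsPeriodicDir φ (N : ℤ) →
      IsPeriodicDir (R φ) ((tower L N (k + 1) : ℕ) : ℤ) := fun φ hφ _ => by
    rw [hRdef φ hφ, htow]; exact rightInvW_periodic hL k hUu hUP' hx hs hUx hθ hφ
  have hRexact : ∀ φ : Site d → Fin d → Matrix n n ℂ, IsSkewDir φ → IsPeriodicDir φ (N : ℤ) → dirIter L (k + 1) U (R φ) = φ := fun φ hφ hφP => by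
    rw [hRdef φ hφ]; exact rightInvW_exact hL k hUu hUP' hx hs hUx hθ hφ hφP
  have hRbd : ∀ φ : Site d → Fin d → Matrix n n ℂ, IsSkewDir φ → IsPeriodicDir φ (N : ℤ) →
      |dAction U (R φ) (perWin d (tower L N (k + 1)))|
        ≤ (a * ((curl1C d L / (1 - thetaLoc d L * (((L : ℝ) ^ (k + 1)) ^ 2 * x))) * (((L : ℝ) ^ (k + 1)) ^ d / ((L : ℝ) ^ (k + 1)) ^ 2)))
          * dirL1 φ (periodBox (d := d) N) := fun φ hφ hφP => by
    rw [hRdef φ hφ, htowN]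
    exact abs_dAction_rightInvW_le hL k hUu hUP' hx hs hUx hθ hθl hε ha hUa hφ
  have hcrit' : ∀ Y' : Site d → Fin d → Matrix n n ℂ, IsSkewDir Y' → IsPeriodicDir Y' ((tower L N (k + 1) : ℕ) : ℤ) →
      dirIter L (k + 1) U Y' = 0 → dAction U Y' (perWin d (tower L N (k + 1))) = 0 := fun Y' hY's hY'P hY'T => by
    rw [htowN]; rw [htow] at hY'P; exact hcrit Y' hY's hY'P hY'T
  have hZP' : IsPeriodicDir Z ((tower L N (k + 1) : ℕ) : ℤ) := by rw [htow]; exact hZP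
  have h := abs_dAction_le_cR_dirL1_dirIter hL1 k hUu hUP' hx hs hUx R hRskew hRper hRexact hRbd hcrit' hZ hZP'
  rwa [htowN] at h

end

end Summit.QuantumFields.BalabanUV.T4Continuum.NE7CriticalPairingLetter
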